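import Summits.ResolutionOfSingularities.ResolutionOfSingularities.Theorems.EquisingularLiftEquisingularLiftNatNormalSheafCoordinates
import Summits.ResolutionOfSingularities.ResolutionOfSingularities.Theorems.EquisingularLiftEquisingularLiftNatRegularSequenceRestrict
import Literature.AlgebraicGeometry.HodgeTheory.RegularImmersionConormalBasis
import Literature.AlgebraicGeometry.Modules.SheafHomAffineSections
import HarnessLib

/-!
# [OURS · L1 W4.5(b) · EL♮(3) · J1c (π) brick F4] The conormal chart dictionary: sections of the normal sheaf on an lci chart
# ARE the semilinear maps out of the ideal sections

Crux chain w45b (cell `res-hironaka`, slot W4.5(b)), child crux **EL♮(3)** = stmt-ResolutionOfSingularities-20148; J1 =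
`EmbeddedInfinitesimalLiftFact` (p596985), discharge programme J1c, brick **(π)** (patching engine, res-type-027 g17; object split STATUS
2026-08-28T05:26Z). OURS; NOT a statement of H. Hironaka's 2017 manuscript; AI-written, gate-checked, weaker than expert review. DEF-FREE; no
`sorry`; standard axioms. `--supports stmt-ResolutionOfSingularities-20148 --as helper`.

SETTING. `ι : Z ⟶ X` a closed immersion, `X` locally Noetherian, `V ⊆ X` an affine open on which the ideal `𝓘(V) = ker(Γ(V,𝒪_X) → Γ(ι⁻¹V,𝒪_Z))`
is generated by a weakly regular sequence `x` (an «lci chart»; the local hypothesis of J1). Write `η(m) ∈ Γ(ι⁻¹V, ι^*𝓘)` for the class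
(`Modules.unitSectionLE ι (idealModule ι) le_rfl m`) of an ideal-module section `m ∈ Γ(V, 𝓘)` in the conormal sheaf `ι^*𝓘 = 𝓘/𝓘²`
(`Deformation.conormalSheaf`), and recall that a section of the normal sheaf `𝒩 = 𝓗om(ι^*𝓘, 𝒪_Z)` (`HodgeTheory.normalSheaf`) over `ι⁻¹V` IS a
morphism `μ : (ι^*𝓘)|_{ι⁻¹V} ⟶ 𝒪_Z|_{ι⁻¹V}` ((S1), `normalSheaf_presheaf_map`, res-L1-w45b-lead-1's (ν1) file …NatNormalSheafCoordinates), with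
values `appLE μ (𝟙 _) (η m) ∈ Γ(ι⁻¹V, 𝒪_Z)`.

THE DICTIONARY (generator-free statements; the generators live inside the proofs, through the conormal basis of GW II Rem. 19.22 =
`HodgeTheory.exists_basis_sections_pullback_idealModule_eq`, and Hartshorne II Prop. 5.2 = `Modules.SheafHomAffineSections.homOfLinear`):
* `exists_normalSection_of_semilinear` — every additive `ψ : Γ(V, 𝓘) → Γ(ι⁻¹V, 𝒪_Z)` that is `ι♯`-semilinear (`ψ(a·m) = ι♯(a)·ψ(m)`; such a `ψ`
  kills `𝓘(V)·Γ(V, 𝓘)` automatically, i.e. is a homomorphism `𝓘/𝓘² → 𝒪_Z` on the chart) is `m ↦ μ(η m)` for a section `μ` of `𝒩` over `ι⁻¹V`;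
* `normalSection_ext_of_generators` / `normalSection_ext` / `normalSection_ext_of_le` — a section of `𝒩` over `ι⁻¹V` (resp. over `ι⁻¹V'` for an
  affine `V' ⊆ V`) is determined by its values on the `η(m)`, `m ∈ Γ(V, 𝓘)` (resp. on the `η(s_j)` for sections `s_j` reading to the generators,
  resp. on the classes of the RESTRICTIONS `m|_{V'}`);
* `appLE_restrictHom_unitSectionLE_map` — naturality: `(μ|_{ι⁻¹V'})(η(m|_{V'})) = (μ(η m))|_{ι⁻¹V'}`.
These are exactly what the chart torsor (F5: difference section / action of a section on a chart lift, through the ring-level `liftDiff` p599860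
and `act` p600361) and the patching (F6) consume. Companion bookkeeping: `exists_eq_sum_smul_of_toRing_eq` (ideal-module sections are combinations of
sections reading to generators), `unitSectionLE_sum_smul` (`η` is `ι♯`-semilinear on sums).

References (method / index only): U. Görtz–T. Wedhorn, *Algebraic Geometry II* (2023), Rem. 19.22; R. Hartshorne, *Algebraic Geometry* (1977),
II Prop. 5.2, II.8; R. Hartshorne, *Deformation Theory* (2010), proof of Thm. 6.2 («`Hom_A(I, B) = Hom_B(I/I², B) = H⁰(𝒩)` in the affine case»).
-/

set_option linter.dupNamespace false -- mandated namespace `Summit.<Summit>.<Problem>` of this single-conjunct summit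

noncomputable section

open CategoryTheory CategoryTheory.Limits AlgebraicGeometry Opposite TopologicalSpace
open Literature.AlgebraicGeometry.Modules Literature.AlgebraicGeometry.Deformation Literature.AlgebraicGeometry.HodgeTheory

namespace Summit.ResolutionOfSingularities.ResolutionOfSingularities.Cruxes.EquisingularLiftNat.Sections

variable {X Z : Scheme.{0}} (ι : Z ⟶ X)

/-! ## Bookkeeping on ideal-module sections and their conormal classes -/

/-- **Ideal-module sections are combinations of sections reading to generators**: if `x` generates `𝓘(V)` and `s_j ↦ x_j`, every
`m ∈ Γ(V, 𝓘)` is `Σ a_j s_j` (the reading `𝓘 ↪ 𝒪` is injective). [folklore] -/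
theorem exists_eq_sum_smul_of_toRing_eq [IsClosedImmersion ι] (V : X.affineOpens) {n : ℕ} (x : Fin n → Γ(X, (V : X.Opens)))
    (hI : Ideal.span (Set.range x) = ι.ker.ideal V) (s : Fin n → Γ(idealModule ι, (V : X.Opens)))
    (hs : ∀ j, toRing (idealModuleι ι) (V : X.Opens) (s j) = x j) (m : Γ(idealModule ι, (V : X.Opens))) :
    ∃ a : Fin n → Γ(X, (V : X.Opens)), m = ∑ j, a j • s j := by
  classical
  have hker : ι.ker.ideal V = RingHom.ker (ι.app (V : X.Opens)).hom := Scheme.Hom.ker_apply ι V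
  have hm : toRing (idealModuleι ι) (V : X.Opens) m ∈ Ideal.span (Set.range x) := by
    rw [hI, hker]
    exact app_idealModuleι_eq_zero ι (V : X.Opens) m
  obtain ⟨a, ha⟩ := Ideal.mem_span_range_iff_exists_fun.1 hm
  refine ⟨a, kernel_ι_app_injective (structureModuleMap ι) (V : X.Opens) ?_⟩
  change toRing (idealModuleι ι) (V : X.Opens) m = ((idealModuleι ι).app (V : X.Opens)).hom (∑ j, a j • s j)
  rw [map_sum, ← ha]
  refine Finset.sum_congr rfl fun j _ => ?_
  rw [← hs j]
  exact (toRing_smul (idealModuleι ι) (V : X.Opens) (a j) (s j)).symm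

/-- **`η` is `ι♯`-semilinear on sums**: `η(Σ a_j s_j) = Σ ι♯(a_j) η(s_j)` in `Γ(ι⁻¹V, ι^*𝓘)`. [folklore] -/
theorem unitSectionLE_sum_smul (V : X.Opens) {n : ℕ} (a : Fin n → Γ(X, V)) (s : Fin n → Γ(idealModule ι, V)) :
    unitSectionLE ι (idealModule ι) (le_refl (ι ⁻¹ᵁ V)) (∑ j, a j • s j) =
      ∑ j, ι.app V (a j) • unitSectionLE ι (idealModule ι) (le_refl (ι ⁻¹ᵁ V)) (s j) := by
  classical
  let η : Γ(idealModule ι, V) →+ Γ(conormalSheaf ι, ι ⁻¹ᵁ V) :=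
    { toFun := unitSectionLE ι (idealModule ι) (le_refl (ι ⁻¹ᵁ V))
      map_zero' := by
        have h := unitSectionLE_add ι (idealModule ι) (le_refl (ι ⁻¹ᵁ V)) (0 : Γ(idealModule ι, V)) 0
        rw [add_zero] at h
        exact left_eq_add.mp h
      map_add' := unitSectionLE_add ι (idealModule ι) (le_refl (ι ⁻¹ᵁ V)) }
  change η (∑ j, a j • s j) = _
  rw [map_sum]
  refine Finset.sum_congr rfl fun j _ => ?_
  change unitSectionLE ι (idealModule ι) (le_refl (ι ⁻¹ᵁ V)) (a j • s j) = _
  rw [unitSectionLE_smul, Scheme.Hom.appLE_eq_app]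

/-- Sections of `𝓘` with the same reading coincide. [folklore] -/
theorem idealModule_section_eq_of_toRing_eq (V : X.Opens) {s s' : Γ(idealModule ι, V)}
    (h : toRing (idealModuleι ι) V s = toRing (idealModuleι ι) V s') : s = s' :=
  kernel_ι_app_injective (structureModuleMap ι) V h

/-- Every element of `𝓘(V)` (`V` affine) is the reading of a section of the ideal module. [folklore] -/
theorem exists_toRing_eq_of_mem_ker_ideal [IsClosedImmersion ι] (V : X.affineOpens) {a : Γ(X, (V : X.Opens))} (ha : a ∈ ι.ker.ideal V) :
    ∃ m : Γ(idealModule ι, (V : X.Opens)), toRing (idealModuleι ι) (V : X.Opens) m = a := by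
  have hker : ι.ker.ideal V = RingHom.ker (ι.app (V : X.Opens)).hom := Scheme.Hom.ker_apply ι V
  rw [hker] at ha
  exact exists_kernel_ι_app_eq (structureModuleMap ι) (V : X.Opens) a ha

/-- The reading of a section of the ideal module lies in `𝓘(V)`. [folklore] -/
theorem toRing_mem_ker_ideal [IsClosedImmersion ι] (V : X.affineOpens) (m : Γ(idealModule ι, (V : X.Opens))) :
    toRing (idealModuleι ι) (V : X.Opens) m ∈ ι.ker.ideal V := by
  rw [Scheme.Hom.ker_apply ι V]
  exact app_idealModuleι_eq_zero ι (V : X.Opens) m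

/-! ## Naturality of the values `μ(η m)` under restriction to a smaller open -/

/-- **Naturality**: for `V' ≤ V` and a morphism `μ : (ι^*𝓘)|_{ι⁻¹V} ⟶ 𝒪|_{ι⁻¹V}` (a section of `𝒩` over `ι⁻¹V`),
`(μ|_{ι⁻¹V'})(η(m|_{V'})) = (μ(η m))|_{ι⁻¹V'}`. [folklore] -/
theorem appLE_restrictHom_unitSectionLE_map {V V' : X.Opens} (k : V' ≤ V)
    (μ : (conormalSheaf ι).over (ι ⁻¹ᵁ V) ⟶ (unitModule Z).over (ι ⁻¹ᵁ V)) (m : Γ(idealModule ι, V)) :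
    appLE (restrictHom (homOfLE (ι.preimage_mono k)) μ) (𝟙 _)
        (unitSectionLE ι (idealModule ι) (le_refl (ι ⁻¹ᵁ V')) ((idealModule ι).presheaf.map (homOfLE k).op m)) =
      Z.presheaf.map (homOfLE (ι.preimage_mono k)).op (appLE μ (𝟙 _) (unitSectionLE ι (idealModule ι) (le_refl (ι ⁻¹ᵁ V)) m)) := by
  rw [unitSectionLE_refl_map, appLE_restrictHom]
  exact (appLE_congr_hom μ _ _ _).trans (appLE_map μ (𝟙 _) (homOfLE (ι.preimage_mono k)) _)

/-! ## The dictionary on an lci chart -/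

section Chart

variable [IsClosedImmersion ι] [IsLocallyNoetherian X]

/-- **A section of `𝒩` over `ι⁻¹V` is determined by its values on the classes `η(s_j)` of sections reading to weakly regular generators of
`𝓘(V)`** (they are a basis of `Γ(ι⁻¹V, ι^*𝓘)`, GW II Rem. 19.22, and `Hom((ι^*𝓘)|_{ι⁻¹V}, 𝒪|_{ι⁻¹V}) ↪ Hom_{𝒪(ι⁻¹V)}(Γ(ι⁻¹V, ι^*𝓘), Γ(ι⁻¹V, 𝒪))`,
Hartshorne II Prop. 5.2). [cite: GortzWedhorn2023, Rem. 19.22] [cite: Hartshorne1977, II Prop. 5.2 (p. 110)] -/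
theorem normalSection_ext_of_generators (V : X.affineOpens) {n : ℕ} (x : Fin n → Γ(X, (V : X.Opens)))
    (hreg : RingTheory.Sequence.IsWeaklyRegular Γ(X, (V : X.Opens)) (List.ofFn x)) (hI : Ideal.span (Set.range x) = ι.ker.ideal V)
    (s : Fin n → Γ(idealModule ι, (V : X.Opens))) (hs : ∀ j, toRing (idealModuleι ι) (V : X.Opens) (s j) = x j)
    {μ μ' : (conormalSheaf ι).over (ι ⁻¹ᵁ (V : X.Opens)) ⟶ (unitModule Z).over (ι ⁻¹ᵁ (V : X.Opens))}
    (h : ∀ j, appLE μ (𝟙 _) (unitSectionLE ι (idealModule ι) (le_refl _) (s j)) = appLE μ' (𝟙 _) (unitSectionLE ι (idealModule ι) (le_refl _) (s j))) :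
    μ = μ' := by
  obtain ⟨s₀, b, hs₀, hb⟩ := exists_basis_sections_pullback_idealModule_eq ι V x hreg hI
  have hss : s₀ = s := funext fun j => idealModule_section_eq_of_toRing_eq ι (V : X.Opens) ((hs₀ j).trans (hs j).symm)
  subst hss
  apply evalHom_injective (coh_conormalSheaf ι).loc (V.2.preimage ι)
  refine b.ext fun j => ?_
  change appLE μ (𝟙 _) (b j) = appLE μ' (𝟙 _) (b j)
  rw [hb j]
  exact h j

/-- **A section of `𝒩` over an lci chart is determined by its values on all classes `η(m)`, `m ∈ Γ(V, 𝓘)`.** [folklore] -/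
theorem normalSection_ext (V : X.affineOpens) {n : ℕ} (x : Fin n → Γ(X, (V : X.Opens)))
    (hreg : RingTheory.Sequence.IsWeaklyRegular Γ(X, (V : X.Opens)) (List.ofFn x)) (hI : Ideal.span (Set.range x) = ι.ker.ideal V)
    {μ μ' : (conormalSheaf ι).over (ι ⁻¹ᵁ (V : X.Opens)) ⟶ (unitModule Z).over (ι ⁻¹ᵁ (V : X.Opens))}
    (h : ∀ m : Γ(idealModule ι, (V : X.Opens)),
      appLE μ (𝟙 _) (unitSectionLE ι (idealModule ι) (le_refl _) m) = appLE μ' (𝟙 _) (unitSectionLE ι (idealModule ι) (le_refl _) m)) :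
    μ = μ' := by
  obtain ⟨s, -, hs, -⟩ := exists_basis_sections_pullback_idealModule_eq ι V x hreg hI
  exact normalSection_ext_of_generators ι V x hreg hI s hs fun j => h (s j)

omit [IsClosedImmersion ι] [IsLocallyNoetherian X] in
/-- Restricted weakly regular generators are weakly regular generators of the ideal on a smaller affine open (B3, `Fin`-indexed form). [folklore] -/
theorem isWeaklyRegular_and_span_eq_of_le {V V' : X.affineOpens} (k : (V' : X.Opens) ≤ V) {n : ℕ} (x : Fin n → Γ(X, (V : X.Opens)))
    (hreg : RingTheory.Sequence.IsWeaklyRegular Γ(X, (V : X.Opens)) (List.ofFn x)) (hI : Ideal.span (Set.range x) = ι.ker.ideal V) :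
    RingTheory.Sequence.IsWeaklyRegular Γ(X, (V' : X.Opens)) (List.ofFn fun j => X.presheaf.map (homOfLE k).op (x j)) ∧
      Ideal.span (Set.range fun j => X.presheaf.map (homOfLE k).op (x j)) = ι.ker.ideal V' := by
  constructor
  · have h := isWeaklyRegular_map_presheaf_map k hreg
    rwa [List.map_ofFn] at h
  · rw [show (fun j => (X.presheaf.map (homOfLE k).op).hom (x j)) = (X.presheaf.map (homOfLE k).op).hom ∘ x from rfl, Set.range_comp,
      ← Ideal.map_span (X.presheaf.map (homOfLE k).op).hom, hI]
    exact ι.ker.map_ideal (show V' ≤ V from k)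

/-- **Determination by restricted classes**: two sections of `𝒩` over `ι⁻¹V'`, `V' ⊆ V` affine, `V` an lci chart, that agree on the classes
`η(m|_{V'})` of the restrictions of all `m ∈ Γ(V, 𝓘)` coincide (the restricted generators generate `𝓘(V')`). [folklore] -/
theorem normalSection_ext_of_le {V V' : X.affineOpens} (k : (V' : X.Opens) ≤ V) {n : ℕ} (x : Fin n → Γ(X, (V : X.Opens)))
    (hreg : RingTheory.Sequence.IsWeaklyRegular Γ(X, (V : X.Opens)) (List.ofFn x)) (hI : Ideal.span (Set.range x) = ι.ker.ideal V)
    {μ μ' : (conormalSheaf ι).over (ι ⁻¹ᵁ (V' : X.Opens)) ⟶ (unitModule Z).over (ι ⁻¹ᵁ (V' : X.Opens))}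
    (h : ∀ m : Γ(idealModule ι, (V : X.Opens)),
      appLE μ (𝟙 _) (unitSectionLE ι (idealModule ι) (le_refl _) ((idealModule ι).presheaf.map (homOfLE k).op m)) =
        appLE μ' (𝟙 _) (unitSectionLE ι (idealModule ι) (le_refl _) ((idealModule ι).presheaf.map (homOfLE k).op m))) :
    μ = μ' := by
  obtain ⟨hreg', hI'⟩ := isWeaklyRegular_and_span_eq_of_le ι k x hreg hI
  obtain ⟨s, -, hs, -⟩ := exists_basis_sections_pullback_idealModule_eq ι V x hreg hI
  refine normalSection_ext_of_generators ι V' _ hreg' hI' (fun j => (idealModule ι).presheaf.map (homOfLE k).op (s j)) (fun j => ?_)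
    fun j => h (s j)
  rw [← map_toRing, hs j]

/-- **The dictionary, existence: `ι♯`-semilinear maps out of `Γ(V, 𝓘)` are sections of `𝒩`.** For an lci chart `V` and any additive
`ψ : Γ(V, 𝓘) → Γ(ι⁻¹V, 𝒪_Z)` with `ψ(a·m) = ι♯(a)·ψ(m)`, there is a section `μ` of `𝒩 = 𝓗om(ι^*𝓘, 𝒪_Z)` over `ι⁻¹V` with `μ(η m) = ψ(m)` for all
`m` (unique by `normalSection_ext`). Proof: the `η(s_j)` are a basis (GW II Rem. 19.22); the `𝒪(ι⁻¹V)`-linear map with values `ψ(s_j)` extends to a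
morphism of sheaves (Hartshorne II Prop. 5.2); both sides are then semilinear in `m = Σ a_j s_j`.
[cite: GortzWedhorn2023, Rem. 19.22] [cite: Hartshorne1977, II Prop. 5.2 (p. 110)] [cite: Hartshorne2010, Thm. 6.2 (proof: `Hom_A(I, B₀) = H⁰(𝒩₀)`)] -/
theorem exists_normalSection_of_semilinear (V : X.affineOpens) {n : ℕ} (x : Fin n → Γ(X, (V : X.Opens)))
    (hreg : RingTheory.Sequence.IsWeaklyRegular Γ(X, (V : X.Opens)) (List.ofFn x)) (hI : Ideal.span (Set.range x) = ι.ker.ideal V)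
    (ψ : Γ(idealModule ι, (V : X.Opens)) → Γ(Z, ι ⁻¹ᵁ (V : X.Opens))) (hadd : ∀ m m', ψ (m + m') = ψ m + ψ m')
    (hsmul : ∀ (a : Γ(X, (V : X.Opens))) (m : Γ(idealModule ι, (V : X.Opens))), ψ (a • m) = ι.app (V : X.Opens) a * ψ m) :
    ∃ μ : (conormalSheaf ι).over (ι ⁻¹ᵁ (V : X.Opens)) ⟶ (unitModule Z).over (ι ⁻¹ᵁ (V : X.Opens)),
      ∀ m : Γ(idealModule ι, (V : X.Opens)), appLE μ (𝟙 _) (unitSectionLE ι (idealModule ι) (le_refl _) m) = ψ m := by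
  classical
  obtain ⟨s, b, hs, hb⟩ := exists_basis_sections_pullback_idealModule_eq ι V x hreg hI
  -- the `𝒪(ι⁻¹V)`-linear map on sections with values `ψ(s_j)` on the basis
  let Ψ : Γ(conormalSheaf ι, ι ⁻¹ᵁ (V : X.Opens)) →ₗ[Γ(Z, ι ⁻¹ᵁ (V : X.Opens))] Γ(unitModule Z, ι ⁻¹ᵁ (V : X.Opens)) :=
    b.constr ℕ fun j => (ψ (s j) : Γ(unitModule Z, ι ⁻¹ᵁ (V : X.Opens)))
  have hΨb : ∀ j, Ψ (unitSectionLE ι (idealModule ι) (le_refl _) (s j)) = ψ (s j) := fun j => by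
    rw [← hb j]
    exact b.constr_basis ℕ _ j
  -- extend it to a morphism of sheaves of modules (Hartshorne II 5.2)
  refine ⟨homOfLinear (coh_conormalSheaf ι).loc (V.2.preimage ι) Ψ, fun m => ?_⟩
  have hev : ∀ t, appLE (homOfLinear (coh_conormalSheaf ι).loc (V.2.preimage ι) Ψ) (𝟙 _) t = Ψ t := fun t => by
    rw [← evalHom_apply, evalHom_homOfLinear]
  rw [hev]
  -- both sides are semilinear in `m = Σ a_j s_j`
  obtain ⟨a, rfl⟩ := exists_eq_sum_smul_of_toRing_eq ι V x hI s hs m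
  let ψ' : Γ(idealModule ι, (V : X.Opens)) →+ Γ(Z, ι ⁻¹ᵁ (V : X.Opens)) :=
    { toFun := ψ
      map_zero' := by
        have h := hadd 0 0
        rw [add_zero] at h
        exact left_eq_add.mp h
      map_add' := hadd }
  have hψsum : ψ (∑ j, a j • s j) = ∑ j, ι.app (V : X.Opens) (a j) * ψ (s j) := by
    change ψ' (∑ j, a j • s j) = _
    rw [map_sum]
    exact Finset.sum_congr rfl fun j _ => hsmul (a j) (s j)
  rw [hψsum, unitSectionLE_sum_smul]
  erw [map_sum]
  refine Finset.sum_congr rfl fun j _ => ?_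
  erw [map_smul, hΨb j]
  rfl

/-- **The dictionary, restricted-generator form of existence is not needed; uniqueness + existence packaged**: on an lci chart, for `ψ` as in
`exists_normalSection_of_semilinear` there is EXACTLY ONE section `μ` of `𝒩` over `ι⁻¹V` with `μ(η m) = ψ(m)`. [folklore] -/
theorem existsUnique_normalSection_of_semilinear (V : X.affineOpens) {n : ℕ} (x : Fin n → Γ(X, (V : X.Opens)))
    (hreg : RingTheory.Sequence.IsWeaklyRegular Γ(X, (V : X.Opens)) (List.ofFn x)) (hI : Ideal.span (Set.range x) = ι.ker.ideal V)
    (ψ : Γ(idealModule ι, (V : X.Opens)) → Γ(Z, ι ⁻¹ᵁ (V : X.Opens))) (hadd : ∀ m m', ψ (m + m') = ψ m + ψ m')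
    (hsmul : ∀ (a : Γ(X, (V : X.Opens))) (m : Γ(idealModule ι, (V : X.Opens))), ψ (a • m) = ι.app (V : X.Opens) a * ψ m) :
    ∃! μ : (conormalSheaf ι).over (ι ⁻¹ᵁ (V : X.Opens)) ⟶ (unitModule Z).over (ι ⁻¹ᵁ (V : X.Opens)),
      ∀ m : Γ(idealModule ι, (V : X.Opens)), appLE μ (𝟙 _) (unitSectionLE ι (idealModule ι) (le_refl _) m) = ψ m := by
  obtain ⟨μ, hμ⟩ := exists_normalSection_of_semilinear ι V x hreg hI ψ hadd hsmul
  exact ⟨μ, hμ, fun μ' hμ' => normalSection_ext ι V x hreg hI fun m => (hμ' m).trans (hμ m).symm⟩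

end Chart

end Summit.ResolutionOfSingularities.ResolutionOfSingularities.Cruxes.EquisingularLiftNat.Sections

end
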